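import Literature.Analysis.FluidPDE.ElgindiStripCalculusTwo
import Literature.Analysis.FluidPDE.ElgindiTransportL2Coercivity
import HarnessLib

/-!
# `D_θ` applied to Elgindi's operator `𝓛_Γ^T`: the commutation formula, the weighted energy of
`𝓛(D_θf)` and the transport term by parts ([Elgindi2021] §6.1, proof of Proposition 6.5, first half)

Topic `Literature/Analysis/FluidPDE`. Proof file (everything proved, no definitions, no named
facts) on the proof path of the named fact
`Literature.Analysis.FluidPDE.Elgindi.ElgindiGhoulMasmoudi2021_stabilityCore`
(`ElgindiStabilityDecomposition.lean`). T. M. Elgindi, Ann. of Math. 194 (2021) =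
arXiv:1904.04795 (`[Elgindi2021]`), §6.1, proof of **Proposition 6.5** (p. 16 of the held text):

> "We write: `𝓛_Γ^T(f) = 𝓛(f) − (2Γz/(c(1+z)²))L₁₂(f) − (3/(1+z))sin(2θ)∂_θf +
> (Γ(θ)/c)(2z²/(1+z)³)L₁₂((3/(1+z))sin(2θ)∂_θf)(0)`. Thus, `D_θ𝓛_Γ^T(f) = 𝓛(D_θf) +
> D_θΓ(−(2z/(c(1+z)²))L₁₂(f) + (1/c)(2z²/(1+z)³)L₁₂((3/(1+z))sin(2θ)∂_θf)(0)) −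
> (3/(1+z))sin(2θ)∂_θD_θf`. … if we multiply `D_θ𝓛_Γ^T(f)` by `w²(1/sin(2θ)^γ)D_θf` and
> integrate, we get: `… ≥ ½|(D_θf)w/√(sin(2θ)^γ)|² − … + (3/2)(∂_θ(sin(2θ)^{−α/10}),
> (w²/(1+z))(D_θf)²)`. The third term comes from integrating the transport term by parts."

This file proves, for `f ∈ C²` compactly supported inside the open strip:

* the regularity of `D_θf` (`C¹`, compactly supported inside the strip);
* **the commutation formula** `D_θ(𝓛_Γ^T f) = 𝓛(D_θf) − (2z/(c(1+z)²))L₁₂(f)·D_θΓ −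
  (3/(1+z))D_θ(D_θf) + L₁₂((3/(1+z))D_θf)(0)·(2z²/(c(1+z)³))·D_θΓ` on the strip (`Dθ_opLΓT`;
  `D_θ` commutes with `𝓛` by `Dθ_Dz_comm`), with `D_θΓ = (2α/3)(1 − 3sin²θ)Γ`
  (`sin_two_mul_mul_deriv_angularWeight`);
* **the first term**: `∬_strip 𝓛(D_θf)·D_θf·w²sin(2θ)^{−γ} = ½∬_strip (D_θf·w)²sin(2θ)^{−γ}`
  (`integral_opL_Dθ_energy`);
* **the transport term by parts**: `−∬_strip (3/(1+z))D_θ(D_θf)·D_θf·w²sin(2θ)^{−γ} =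
  −(α/10)∬_strip (3cos(2θ)/(1+z))(D_θf)²w²sin(2θ)^{−γ}` (`integral_transport_Dθ_byParts`), hence
  `≥ −(3α/10)∬(D_θf·w)²sin(2θ)^{−γ}` (`integral_transport_Dθ_ge`).

The remaining (`Γ'`-) terms and the assembly of Prop. 6.5 are in the next file.
-/

noncomputable section

open MeasureTheory Set Function Real Filter
open _root_.Topology

namespace Literature.Analysis.FluidPDE

namespace Elgindi

/-! ### `D_θ f` of a `C²` test function -/

/-- `D_θ f` is supported inside the support of `f`. [folklore] -/
theorem tsupport_Dθ_subset {f : ℝ → ℝ → ℝ} : tsupport (uncurry (Dθ f)) ⊆ tsupport (uncurry f) := by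
  refine closure_minimal (fun p hp => ?_) (isClosed_tsupport _)
  by_contra h
  exact hp (Dθ_eq_zero_of_notMem_tsupport (p := p) h)

/-- For `f ∈ C^{n+1}` compactly supported inside the open strip, `D_θ f` is `Cⁿ` on the plane. [folklore] -/
theorem contDiff_Dθ {f : ℝ → ℝ → ℝ} {n : ℕ} (hf : ContDiff ℝ (n + 1) (uncurry f))
    (hsub : tsupport (uncurry f) ⊆ strip) : ContDiff ℝ n (uncurry (Dθ f)) :=
  contDiff_of_contDiffOn_strip (contDiffOn_Dθ (n := n) (by exact_mod_cast hf.contDiffOn))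
    (tsupport_Dθ_subset.trans hsub)

/-- `D_θ f` of a compactly supported `f` is compactly supported. [folklore] -/
theorem hasCompactSupport_Dθ {f : ℝ → ℝ → ℝ} (hs : HasCompactSupport (uncurry f)) :
    HasCompactSupport (uncurry (Dθ f)) :=
  hs.mono' ((subset_tsupport _).trans tsupport_Dθ_subset)

/-! ### `D_θ` of the pieces of `𝓛_Γ^T` -/

/-- `D_θ(R(z)·F) = R(z)·D_θF` for a radial factor (unconditionally). [folklore] -/
theorem Dθ_radial_mul (R : ℝ → ℝ) (F : ℝ → ℝ → ℝ) (z θ : ℝ) :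
    Dθ (fun z' θ' => R z' * F z' θ') z θ = R z * Dθ F z θ := by
  simp only [Dθ, deriv_const_mul_field]
  ring

/-- `D_θ(F·a) = D_θF·a` for a constant (unconditionally). [folklore] -/
theorem Dθ_mul_const (F : ℝ → ℝ → ℝ) (a : ℝ) (z θ : ℝ) :
    Dθ (fun z' θ' => F z' θ' * a) z θ = Dθ F z θ * a := by
  simp only [Dθ, deriv_mul_const_field]
  ring

/-- The explicit `D_θΓ`: on the open quarter, `D_θ(R(z)Γ) = R(z)·(2α/3)(1 − 3sin²θ)Γ`. [folklore] -/
theorem Dθ_radial_mul_angularWeight (α : ℝ) (R : ℝ → ℝ) {p : ℝ × ℝ} (hp : p ∈ strip) :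
    Dθ (fun z θ => R z * angularWeight α θ) p.1 p.2 =
      R p.1 * (2 * α / 3 * (1 - 3 * Real.sin p.2 ^ 2) * angularWeight α p.2) := by
  rw [Dθ_radial_mul, Dθ_apply, ← sin_two_mul_mul_deriv_angularWeight α hp.2]

/-- **`D_θ` commutes with `𝓛`** on the open strip for `f ∈ C²(strip)`:
`D_θ(𝓛 f) = 𝓛(D_θ f)` (`D_θD_z = D_zD_θ`, the other terms are radial multiples). [folklore] -/
theorem Dθ_opL {f : ℝ → ℝ → ℝ} (hf : ContDiffOn ℝ 2 (uncurry f) strip) {p : ℝ × ℝ} (hp : p ∈ strip) :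
    Dθ (opL f) p.1 p.2 = opL (Dθ f) p.1 p.2 := by
  -- differentiability of the `θ`-slices at `p.2`
  have hfd : DifferentiableAt ℝ (fun θ => f p.1 θ) p.2 :=
    (hasDerivAt_slice_snd (differentiableAt_of_contDiffOn_strip hf (by simp) hp)).differentiableAt
  have h1 : ContDiffOn ℝ 1 (uncurry (Dz f)) strip := contDiffOn_Dz (n := 1) hf
  have hDzd : DifferentiableAt ℝ (fun θ => Dz f p.1 θ) p.2 :=
    (hasDerivAt_slice_snd (differentiableAt_of_contDiffOn_strip h1 one_ne_zero hp)).differentiableAt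
  have e : (fun θ => opL f p.1 θ) = fun θ => (f p.1 θ + Dz f p.1 θ) - 2 / (1 + p.1) * f p.1 θ := by
    funext θ
    simp only [opL_apply]
    ring
  have h := ((hfd.hasDerivAt.fun_add hDzd.hasDerivAt).fun_sub (hfd.hasDerivAt.const_mul (2 / (1 + p.1))))
  rw [Dθ_apply, e, h.deriv, opL_apply]
  have hc := Dθ_Dz_comm hf hp
  simp only [Dθ_apply] at hc ⊢
  rw [← hc]
  ring

/-- **The commutation formula for `D_θ𝓛_Γ^T`** on the open strip, for `f ∈ C²(strip)` and
`α` arbitrary: `D_θ(𝓛_Γ^T f) = 𝓛(D_θf) − (2z/(c(1+z)²))L₁₂(f)(z)·D_θΓ − (3/(1+z))D_θ(D_θf) +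
L₁₂((3/(1+z))D_θf)(0)·(2z²/(1+z)³/c)·D_θΓ`, `D_θΓ = (2α/3)(1 − 3sin²θ)Γ` (Elgindi 2021, proof of
Prop. 6.5, display "`D_θ𝓛_Γ^T(f) = 𝓛(D_θf) + D_θΓ(…) − (3/(1+z))sin(2θ)∂_θD_θf`"). [cite: Elgindi2021, §6.1, proof of Proposition 6.5 (p. 16 of arXiv:1904.04795)] -/
theorem Dθ_opLΓT {α : ℝ} {f : ℝ → ℝ → ℝ} (hf : ContDiffOn ℝ 2 (uncurry f) strip) {p : ℝ × ℝ}
    (hp : p ∈ strip) :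
    Dθ (opLΓT α f) p.1 p.2 =
      opL (Dθ f) p.1 p.2
        - 2 * p.1 / (profileConst α * (1 + p.1) ^ 2) * L12 f p.1 *
            (2 * α / 3 * (1 - 3 * Real.sin p.2 ^ 2) * angularWeight α p.2)
        - 3 / (1 + p.1) * Dθ (Dθ f) p.1 p.2
        + L12 (fun z θ => 3 / (1 + z) * Dθ f z θ) 0 *
            (2 * p.1 ^ 2 / (1 + p.1) ^ 3 / profileConst α *
              (2 * α / 3 * (1 - 3 * Real.sin p.2 ^ 2) * angularWeight α p.2)) := by
  set ℓ₀ : ℝ := L12 (fun z θ => 3 / (1 + z) * Dθ f z θ) 0 with hℓ₀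
  -- differentiability of the four `θ`-slices at `p.2`
  have hfd : DifferentiableAt ℝ (fun θ => f p.1 θ) p.2 :=
    (hasDerivAt_slice_snd (differentiableAt_of_contDiffOn_strip hf (by simp) hp)).differentiableAt
  have h1z : ContDiffOn ℝ 1 (uncurry (Dz f)) strip := contDiffOn_Dz (n := 1) hf
  have hDzd : DifferentiableAt ℝ (fun θ => Dz f p.1 θ) p.2 :=
    (hasDerivAt_slice_snd (differentiableAt_of_contDiffOn_strip h1z one_ne_zero hp)).differentiableAt
  have h1θ : ContDiffOn ℝ 1 (uncurry (Dθ f)) strip := contDiffOn_Dθ (n := 1) hf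
  have hDθd : DifferentiableAt ℝ (fun θ => Dθ f p.1 θ) p.2 :=
    (hasDerivAt_slice_snd (differentiableAt_of_contDiffOn_strip h1θ one_ne_zero hp)).differentiableAt
  have hΓd : DifferentiableAt ℝ (angularWeight α) p.2 := (hasDerivAt_angularWeight α hp.2).differentiableAt
  have hopLd : DifferentiableAt ℝ (fun θ => opL f p.1 θ) p.2 := by
    have e : (fun θ => opL f p.1 θ) = fun θ => (f p.1 θ + Dz f p.1 θ) - 2 / (1 + p.1) * f p.1 θ := by
      funext θ; simp only [opL_apply]; ring
    rw [e]
    exact (hfd.add hDzd).sub (hfd.const_mul _)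
  have hT2d : DifferentiableAt ℝ (fun θ => 2 * p.1 * angularWeight α θ / (profileConst α * (1 + p.1) ^ 2) *
      L12 f p.1) p.2 := ((hΓd.const_mul _).div_const _).mul_const _
  have hT3d : DifferentiableAt ℝ (fun θ => 3 / (1 + p.1) * Dθ f p.1 θ) p.2 := hDθd.const_mul _
  have hT4d : DifferentiableAt ℝ (fun θ => projKernel α p.1 θ * ℓ₀) p.2 := by
    unfold projKernel
    exact ((hΓd.div_const _).mul_const _).mul_const _
  -- the slice of `𝓛_Γ^T f` as a combination of the four slices
  have e : (fun θ => opLΓT α f p.1 θ) = fun θ => ((opL f p.1 θ -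
      2 * p.1 * angularWeight α θ / (profileConst α * (1 + p.1) ^ 2) * L12 f p.1) -
      3 / (1 + p.1) * Dθ f p.1 θ) + projKernel α p.1 θ * ℓ₀ := by
    funext θ
    simp only [opLΓT_apply, opLΓ_apply, projP, hℓ₀]
    ring
  have hmain : deriv (fun θ => opLΓT α f p.1 θ) p.2 =
      deriv (fun θ => opL f p.1 θ) p.2
        - deriv (fun θ => 2 * p.1 * angularWeight α θ / (profileConst α * (1 + p.1) ^ 2) * L12 f p.1) p.2
        - deriv (fun θ => 3 / (1 + p.1) * Dθ f p.1 θ) p.2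
        + deriv (fun θ => projKernel α p.1 θ * ℓ₀) p.2 := by
    have h := ((hopLd.hasDerivAt.fun_sub hT2d.hasDerivAt).fun_sub hT3d.hasDerivAt).fun_add hT4d.hasDerivAt
    rw [e, h.deriv]
  -- evaluate the four derivatives
  have d1 : Real.sin (2 * p.2) * deriv (fun θ => opL f p.1 θ) p.2 = opL (Dθ f) p.1 p.2 := by
    rw [← Dθ_apply]; exact Dθ_opL hf hp
  have d2 : Real.sin (2 * p.2) * deriv (fun θ => 2 * p.1 * angularWeight α θ /
      (profileConst α * (1 + p.1) ^ 2) * L12 f p.1) p.2 =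
      2 * p.1 / (profileConst α * (1 + p.1) ^ 2) * L12 f p.1 *
        (2 * α / 3 * (1 - 3 * Real.sin p.2 ^ 2) * angularWeight α p.2) := by
    have h := Dθ_radial_mul_angularWeight α (fun z => 2 * z / (profileConst α * (1 + z) ^ 2) * L12 f z) hp
    simp only [Dθ_apply] at h
    have e2 : (fun θ => 2 * p.1 * angularWeight α θ / (profileConst α * (1 + p.1) ^ 2) * L12 f p.1) =
        fun θ => 2 * p.1 / (profileConst α * (1 + p.1) ^ 2) * L12 f p.1 * angularWeight α θ := by
      funext θ; ring
    rw [e2, h]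
  have d3 : Real.sin (2 * p.2) * deriv (fun θ => 3 / (1 + p.1) * Dθ f p.1 θ) p.2 =
      3 / (1 + p.1) * Dθ (Dθ f) p.1 p.2 := by
    rw [deriv_const_mul _ hDθd, Dθ_apply]; ring
  have d4 : Real.sin (2 * p.2) * deriv (fun θ => projKernel α p.1 θ * ℓ₀) p.2 =
      ℓ₀ * (2 * p.1 ^ 2 / (1 + p.1) ^ 3 / profileConst α *
        (2 * α / 3 * (1 - 3 * Real.sin p.2 ^ 2) * angularWeight α p.2)) := by
    have h := Dθ_radial_mul_angularWeight α (fun z => 2 * z ^ 2 / (1 + z) ^ 3 / profileConst α * ℓ₀) hp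
    simp only [Dθ_apply] at h
    have e4 : (fun θ => projKernel α p.1 θ * ℓ₀) =
        fun θ => 2 * p.1 ^ 2 / (1 + p.1) ^ 3 / profileConst α * ℓ₀ * angularWeight α θ := by
      funext θ; simp only [projKernel]; ring
    rw [e4, h]
    ring
  rw [Dθ_apply, hmain, mul_add, mul_sub, mul_sub, d1, d2, d3, d4]

/-! ### The first term: the weighted energy of `𝓛(D_θ f)` -/

/-- The weight `sin(2θ)^{−γ}` is `C¹` on `(0, π/2)`. [folklore] -/
theorem contDiffOn_sin_two_mul_rpow (e : ℝ) :
    ContDiffOn ℝ 1 (fun θ : ℝ => Real.sin (2 * θ) ^ e) (Ioo 0 (π / 2)) := by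
  refine ContDiffOn.rpow_const_of_ne (by fun_prop) fun θ hθ => ?_
  exact (Real.sin_pos_of_pos_of_lt_pi (by linarith [hθ.1]) (by linarith [hθ.2])).ne'

/-- **`∬_strip 𝓛(D_θf)·D_θf·w²sin(2θ)^{−γ} = ½∬_strip (D_θf·w)²sin(2θ)^{−γ}`** for `f ∈ C²`
compactly supported inside the open strip (the term "`½|(D_θf)w/√(sin(2θ)^γ)|²`" of the proof of
Prop. 6.5). [cite: Elgindi2021, §6.1, proof of Proposition 6.5 (p. 16 of arXiv:1904.04795)] -/
theorem integral_opL_Dθ_energy {α : ℝ} {f : ℝ → ℝ → ℝ} (hf : ContDiff ℝ 2 (uncurry f))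
    (hs : HasCompactSupport (uncurry f)) (hsub : tsupport (uncurry f) ⊆ strip) :
    ∫ p in strip, opL (Dθ f) p.1 p.2 * Dθ f p.1 p.2 * radialWeight p.1 ^ 2 *
        Real.sin (2 * p.2) ^ (-gammaExp α) =
      (1 / 2) * ∫ p in strip, (Dθ f p.1 p.2 * radialWeight p.1) ^ 2 *
        Real.sin (2 * p.2) ^ (-gammaExp α) :=
  integral_strip_opL_energy_weight (contDiff_Dθ (n := 1) hf hsub) (hasCompactSupport_Dθ hs)
    (tsupport_Dθ_subset.trans hsub) (contDiffOn_sin_two_mul_rpow _)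

/-! ### The transport term by parts -/

/-- **The transport term by parts**: for `f ∈ C²` compactly supported inside the open strip,
`∬_strip (3/(1+z))D_θ(D_θf)·D_θf·w²sin(2θ)^{−γ} = (α/10)∬_strip (3cos(2θ)/(1+z))(D_θf)²w²sin(2θ)^{−γ}`
(`D_θ(D_θf)·D_θf = ½sin(2θ)∂_θ(D_θf)²`, then `∬ u∂_θG = −∬ u'G` with `u = sin(2θ)^{1−γ}`,
`u' = (1−γ)2cos(2θ)sin(2θ)^{−γ}`, `1 − γ = −α/10`; "The third term comes from integrating the
transport term by parts", proof of Prop. 6.5). [cite: Elgindi2021, §6.1, proof of Proposition 6.5 (p. 16 of arXiv:1904.04795)] -/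
theorem integral_transport_Dθ_byParts {α : ℝ} {f : ℝ → ℝ → ℝ} (hf : ContDiff ℝ 2 (uncurry f))
    (hs : HasCompactSupport (uncurry f)) (hsub : tsupport (uncurry f) ⊆ strip) :
    ∫ p in strip, 3 / (1 + p.1) * Dθ (Dθ f) p.1 p.2 * Dθ f p.1 p.2 * radialWeight p.1 ^ 2 *
        Real.sin (2 * p.2) ^ (-gammaExp α) =
      (α / 10) * ∫ p in strip, 3 * Real.cos (2 * p.2) / (1 + p.1) * Dθ f p.1 p.2 ^ 2 *
        radialWeight p.1 ^ 2 * Real.sin (2 * p.2) ^ (-gammaExp α) := by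
  set γ : ℝ := gammaExp α with hγ
  set g : ℝ → ℝ → ℝ := Dθ f with hg
  have hgC : ContDiff ℝ 1 (uncurry g) := contDiff_Dθ (n := 1) hf hsub
  have hgs : HasCompactSupport (uncurry g) := hasCompactSupport_Dθ hs
  have hgsub : tsupport (uncurry g) ⊆ strip := tsupport_Dθ_subset.trans hsub
  -- `G = (3w²/(2(1+z))) g²`, `u = sin(2θ)^{1−γ}`
  set G : ℝ × ℝ → ℝ := fun p => 3 * radialWeight p.1 ^ 2 / (2 * (1 + p.1)) * g p.1 p.2 ^ 2 with hG
  set u : ℝ → ℝ := fun θ => Real.sin (2 * θ) ^ (1 - γ) with hu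
  have hw : ContDiffOn ℝ 1 (fun p : ℝ × ℝ => radialWeight p.1) strip := by
    unfold radialWeight
    exact ContDiffOn.div (by fun_prop) (by fun_prop) fun p hp => pow_ne_zero 2 (ne_of_gt hp.1)
  have hGon : ContDiffOn ℝ 1 G strip := by
    refine (ContDiffOn.div ((hw.pow 2).const_smul (3 : ℝ) |>.congr fun p _ => by
      simp [smul_eq_mul]) (by fun_prop) fun p hp => ?_).mul (hgC.contDiffOn.pow 2)
    have : (0 : ℝ) < p.1 := hp.1; positivity
  have hG_sub : tsupport G ⊆ tsupport (uncurry g) := by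
    have : G = fun p => uncurry g p * (3 * radialWeight p.1 ^ 2 / (2 * (1 + p.1)) * g p.1 p.2) := by
      funext p; simp only [hG, uncurry]; ring
    rw [this]
    exact tsupport_mul_subset_left
  have hGs : HasCompactSupport G := by
    have : G = fun p => uncurry g p * (3 * radialWeight p.1 ^ 2 / (2 * (1 + p.1)) * g p.1 p.2) := by
      funext p; simp only [hG, uncurry]; ring
    rw [this]
    exact hgs.mul_right
  have huC : ContDiffOn ℝ 1 u (Ioo 0 (π / 2)) := contDiffOn_sin_two_mul_rpow _
  have hbp := integral_strip_weight_mul_deriv_slice_snd hGon hGs (hG_sub.trans hgsub) huC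
  -- the derivative of `u` and of the `θ`-slice of `G` on the strip
  have hu' : ∀ θ ∈ Ioo 0 (π / 2), deriv u θ = (1 - γ) * (2 * Real.cos (2 * θ)) * Real.sin (2 * θ) ^ (-γ) := by
    intro θ hθ
    have hsθ : 0 < Real.sin (2 * θ) := Real.sin_pos_of_pos_of_lt_pi (by linarith [hθ.1]) (by linarith [hθ.2])
    have h1 : HasDerivAt (fun θ : ℝ => Real.sin (2 * θ)) (Real.cos (2 * θ) * 2) θ := by
      simpa using ((hasDerivAt_id θ).const_mul (2 : ℝ)).sin
    have h2 := h1.rpow_const (p := 1 - γ) (Or.inl hsθ.ne')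
    rw [show u = fun θ => Real.sin (2 * θ) ^ (1 - γ) from rfl, h2.deriv]
    rw [show (1 : ℝ) - γ - 1 = -γ by ring]
    ring
  have hGsl : ∀ p ∈ strip, deriv (fun θ => G (p.1, θ)) p.2 =
      3 * radialWeight p.1 ^ 2 / (2 * (1 + p.1)) * (2 * g p.1 p.2 * dθ g p.1 p.2) := by
    intro p hp
    have hgd : HasDerivAt (fun θ => g p.1 θ) (dθ g p.1 p.2) p.2 := by
      have hd : DifferentiableAt ℝ (uncurry g) p := (hgC.differentiable (by norm_num)) p
      have h := hasDerivAt_slice_snd hd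
      rw [dθ_eq_fderiv hd]
      exact h
    have := ((hgd.fun_pow 2).const_mul (3 * radialWeight p.1 ^ 2 / (2 * (1 + p.1)))).deriv
    simp only [hG]
    rw [this]
    ring
  -- rewrite both sides of the by-parts identity
  have eL : ∫ p in strip, u p.2 * deriv (fun θ => G (p.1, θ)) p.2 =
      ∫ p in strip, 3 / (1 + p.1) * Dθ (Dθ f) p.1 p.2 * Dθ f p.1 p.2 * radialWeight p.1 ^ 2 *
        Real.sin (2 * p.2) ^ (-γ) := by
    refine setIntegral_congr_fun measurableSet_strip fun p hp => ?_
    have hsθ : 0 < Real.sin (2 * p.2) :=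
      Real.sin_pos_of_pos_of_lt_pi (by linarith [hp.2.1]) (by linarith [hp.2.2])
    rw [hGsl p hp]
    simp only [hu, hg, Dθ_eq_mul_dθ]
    have e1 : Real.sin (2 * p.2) ^ (1 - γ) = Real.sin (2 * p.2) * Real.sin (2 * p.2) ^ (-γ) := by
      rw [show (1 : ℝ) - γ = 1 + -γ by ring, Real.rpow_add hsθ, Real.rpow_one]
    rw [e1]
    have hz1 : (1 : ℝ) + p.1 ≠ 0 := by have : (0 : ℝ) < p.1 := hp.1; positivity
    field_simp
  have eR : ∫ p in strip, deriv u p.2 * G p =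
      -(α / 10) * ∫ p in strip, 3 * Real.cos (2 * p.2) / (1 + p.1) * Dθ f p.1 p.2 ^ 2 *
        radialWeight p.1 ^ 2 * Real.sin (2 * p.2) ^ (-γ) := by
    rw [← integral_const_mul]
    refine setIntegral_congr_fun measurableSet_strip fun p hp => ?_
    rw [hu' p.2 hp.2]
    simp only [hG, hg, hγ, gammaExp]
    have hz1 : (1 : ℝ) + p.1 ≠ 0 := by have : (0 : ℝ) < p.1 := hp.1; positivity
    field_simp
    ring
  rw [eL, eR] at hbp
  rw [hbp]
  ring

/-- **The transport term is perturbative**: `−∬(3/(1+z))D_θ(D_θf)·D_θf·w²sin(2θ)^{−γ} ≥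
−(3α/10)∬(D_θf·w)²sin(2θ)^{−γ}` (`|cos 2θ| ≤ 1`, `1/(1+z) ≤ 1`), `α ≥ 0`. [cite: Elgindi2021, §6.1, proof of Proposition 6.5 (p. 16 of arXiv:1904.04795)] -/
theorem integral_transport_Dθ_ge {α : ℝ} (hα : 0 ≤ α) {f : ℝ → ℝ → ℝ} (hf : ContDiff ℝ 2 (uncurry f))
    (hs : HasCompactSupport (uncurry f)) (hsub : tsupport (uncurry f) ⊆ strip) :
    -(3 * α / 10) * ∫ p in strip, (Dθ f p.1 p.2 * radialWeight p.1) ^ 2 *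
        Real.sin (2 * p.2) ^ (-gammaExp α) ≤
      -∫ p in strip, 3 / (1 + p.1) * Dθ (Dθ f) p.1 p.2 * Dθ f p.1 p.2 * radialWeight p.1 ^ 2 *
        Real.sin (2 * p.2) ^ (-gammaExp α) := by
  rw [integral_transport_Dθ_byParts hf hs hsub]
  -- integrability of `(D_θf·w)² sin^{-γ}` and of the cosine-weighted version
  have hgC : ContDiff ℝ 1 (uncurry (Dθ f)) := contDiff_Dθ (n := 1) hf hsub
  have hgs : HasCompactSupport (uncurry (Dθ f)) := hasCompactSupport_Dθ hs
  have hgsub : tsupport (uncurry (Dθ f)) ⊆ strip := tsupport_Dθ_subset.trans hsub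
  have hg0 : ∀ p : ℝ × ℝ, p ∉ tsupport (uncurry (Dθ f)) → Dθ f p.1 p.2 = 0 := fun p hp =>
    (image_eq_zero_of_notMem_tsupport hp : uncurry (Dθ f) p = 0)
  have hwon : ContinuousOn (fun p : ℝ × ℝ => radialWeight p.1) strip := by
    unfold radialWeight
    exact ContinuousOn.div (by fun_prop) (by fun_prop) fun p hp => pow_ne_zero 2 (ne_of_gt hp.1)
  have hρon : ContinuousOn (fun p : ℝ × ℝ => Real.sin (2 * p.2) ^ (-gammaExp α)) strip :=
    ((contDiffOn_sin_two_mul_rpow (-gammaExp α)).continuousOn).comp continuousOn_snd fun p hp => hp.2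
  have hint : ∀ {c : ℝ × ℝ → ℝ}, ContinuousOn c strip → IntegrableOn (fun p : ℝ × ℝ =>
      c p * Dθ f p.1 p.2 ^ 2 * radialWeight p.1 ^ 2 * Real.sin (2 * p.2) ^ (-gammaExp α)) strip := by
    intro c hc
    have hcont : Continuous fun p : ℝ × ℝ =>
        c p * Dθ f p.1 p.2 ^ 2 * radialWeight p.1 ^ 2 * Real.sin (2 * p.2) ^ (-gammaExp α) :=
      continuous_of_continuousOn_strip (isClosed_tsupport _) hgsub
        (((hc.mul (hgC.continuous.continuousOn.pow 2)).mul (hwon.pow 2)).mul hρon)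
        fun p hp => by simp [hg0 p hp]
    exact (hcont.integrable_of_hasCompactSupport (HasCompactSupport.intro hgs fun p hp => by
      simp [hg0 p hp])).integrableOn
  have i1 := hint (c := fun _ => (1 : ℝ)) continuousOn_const
  have i2 := hint (c := fun p : ℝ × ℝ => 3 * Real.cos (2 * p.2) / (1 + p.1))
    (ContinuousOn.div (by fun_prop) (by fun_prop) fun p hp => by
      have : (0 : ℝ) < p.1 := hp.1; positivity)
  have hY : ∫ p in strip, (Dθ f p.1 p.2 * radialWeight p.1) ^ 2 * Real.sin (2 * p.2) ^ (-gammaExp α) =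
      ∫ p in strip, 1 * Dθ f p.1 p.2 ^ 2 * radialWeight p.1 ^ 2 * Real.sin (2 * p.2) ^ (-gammaExp α) :=
    setIntegral_congr_fun measurableSet_strip fun p _ => by ring
  -- `|∬ (3cos2θ/(1+z)) g² w² ρ| ≤ 3 ∬ g² w² ρ`
  have hbound : |∫ p in strip, 3 * Real.cos (2 * p.2) / (1 + p.1) * Dθ f p.1 p.2 ^ 2 *
      radialWeight p.1 ^ 2 * Real.sin (2 * p.2) ^ (-gammaExp α)| ≤
      3 * ∫ p in strip, (Dθ f p.1 p.2 * radialWeight p.1) ^ 2 * Real.sin (2 * p.2) ^ (-gammaExp α) := by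
    rw [hY, ← integral_const_mul]
    refine abs_integral_le_integral_abs.trans (setIntegral_mono_on i2.abs (i1.const_mul _)
      measurableSet_strip fun p hp => ?_)
    have hz : (0 : ℝ) < p.1 := hp.1
    have hsθ : 0 < Real.sin (2 * p.2) :=
      Real.sin_pos_of_pos_of_lt_pi (by linarith [hp.2.1]) (by linarith [hp.2.2])
    have hρ0 : 0 ≤ Real.sin (2 * p.2) ^ (-gammaExp α) := Real.rpow_nonneg hsθ.le _
    have hc : |3 * Real.cos (2 * p.2) / (1 + p.1)| ≤ 3 := by
      rw [abs_div, abs_of_pos (by positivity : (0 : ℝ) < 1 + p.1), div_le_iff₀ (by positivity), abs_mul,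
        abs_of_pos (by norm_num : (0 : ℝ) < 3)]
      nlinarith [Real.abs_cos_le_one (2 * p.2), abs_nonneg (Real.cos (2 * p.2))]
    rw [abs_mul, abs_mul, abs_mul, abs_of_nonneg hρ0, abs_sq, abs_sq]
    have hnn : 0 ≤ Dθ f p.1 p.2 ^ 2 * radialWeight p.1 ^ 2 * Real.sin (2 * p.2) ^ (-gammaExp α) := by
      positivity
    calc |3 * Real.cos (2 * p.2) / (1 + p.1)| * Dθ f p.1 p.2 ^ 2 * radialWeight p.1 ^ 2 *
          Real.sin (2 * p.2) ^ (-gammaExp α)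
        = |3 * Real.cos (2 * p.2) / (1 + p.1)| * (Dθ f p.1 p.2 ^ 2 * radialWeight p.1 ^ 2 *
          Real.sin (2 * p.2) ^ (-gammaExp α)) := by ring
      _ ≤ 3 * (Dθ f p.1 p.2 ^ 2 * radialWeight p.1 ^ 2 * Real.sin (2 * p.2) ^ (-gammaExp α)) :=
          mul_le_mul_of_nonneg_right hc hnn
      _ = 3 * (1 * Dθ f p.1 p.2 ^ 2 * radialWeight p.1 ^ 2 * Real.sin (2 * p.2) ^ (-gammaExp α)) := by ring
  have h := (abs_le.1 hbound).2
  nlinarith [h, hα]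

end Elgindi

end Literature.Analysis.FluidPDE
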